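import Mathlib
import Summits.ValiantsHypothesis.ValiantsHypothesis.Theorems.NewtonUnitEquationsDissociatedUniformTotalsLawChartTops
import Summits.ValiantsHypothesis.ValiantsHypothesis.Theorems.NewtonUnitEquationsDissociatedUniformTotalsLawChartLevels
import HarnessLib

/-!
# Crux `NewtonUnitEquations.DissociatedUniform` (stmt-ValiantsHypothesis-5905): totals law — the Clarkson–Shor count of low tie events

Companion of `…TotalsLawChartLevels` (`lowEvents σ F k`: the (time, value) pairs at which two points of the finite planar set `F`
tie along the chart `t ↦ (σ, t)` with fewer than `k` points strictly above; `topTies σ R`, `card_topTies_le : #topTies ≤ |R|`).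
Here the `(≤ k)`-LEVEL BOUND in its double-counting form and a linear corollary:

* `card_lowEvents_mul_choose_le`: for every `m ≥ 2`,
  `#lowEvents σ F k · C(|F| - 1 - k, m - 2) ≤ m · C(|F|, m)`.
  Double count pairs (event `e`, `m`-subset `R ⊆ F`) with `R` containing two tied points of `e` and no point strictly above `e`:
  each low event is charged by at least `C(|F| - 1 - k, m - 2)` subsets, and for a fixed `R` the charging events have pairwise
  distinct times which are top ties of `R`, at most `|R| = m` of them.
* `card_lowEvents_le`: `#lowEvents σ F k ≤ 16 · |F| · k` for `k ≥ 1` (take `m = ⌊|F| / 4k⌋` when `|F| ≥ 16k`; the binomial ratio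
  is controlled by the union bound `(N - s r)·C(N, r) ≤ N·C(N - s, r)`).
Honest label: classical tool (levels in line arrangements), proved from scratch for the depth bookkeeping of memo
`Cruxes/DissociatedUniform/NOTES-t1g4.md` §4 (R3); nothing here bears on VP ≠ VNP.
[folklore: Clarkson–Shor random sampling / the `O(nk)` bound for the `(≤ k)`-level of `n` lines]
-/

set_option linter.dupNamespace false -- `ValiantsHypothesis.ValiantsHypothesis` (summit = problem) in every name

open scoped BigOperators

namespace Summit.ValiantsHypothesis.ValiantsHypothesis.Theorems.NewtonUnitEquationsDissociatedUniform

namespace TotalsLaw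

open Literature.Computability.AlgebraicComplexity.KPTT.PlanarMinkowski

/-! ### The double count -/

/-- **Clarkson–Shor inequality for low tie events.**  For `m ≥ 2`:
`#lowEvents σ F k · C(|F| - 1 - k, m - 2) ≤ m · C(|F|, m)`. [folklore: Clarkson–Shor] -/
theorem card_lowEvents_mul_choose_le {σ : ℝ} (hσ : σ ≠ 0) (F : Finset (Fin 2 → ℝ)) (k m : ℕ) (hm : 2 ≤ m) :
    (lowEvents σ F k).card * (F.card - 1 - k).choose (m - 2) ≤ m * F.card.choose m := by
  classical
  set E := lowEvents σ F k with hE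
  set 𝓟 := F.powersetCard m with h𝓟
  -- two tied points for every event
  have hpair : ∀ e ∈ E, ∃ pq : (Fin 2 → ℝ) × (Fin 2 → ℝ),
      pq.1 ∈ F ∧ pq.2 ∈ F ∧ pq.1 ≠ pq.2 ∧ ![σ, e.1] ⬝ᵥ pq.1 = e.2 ∧ ![σ, e.1] ⬝ᵥ pq.2 = e.2 := by
    intro e he
    obtain ⟨p, hp, q, hq, hpq, hpv, hqv⟩ := exists_pair_of_two_le_card_tied ((mem_lowEvents hσ).1 he).1
    exact ⟨(p, q), hp, hq, hpq, hpv, hqv⟩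
  choose! π hπ1 hπ2 hπne hπv1 hπv2 using hpair
  -- the charging predicate
  let P : ℝ × ℝ → Finset (Fin 2 → ℝ) → Prop :=
    fun e R => (π e).1 ∈ R ∧ (π e).2 ∈ R ∧ ∀ y ∈ R, ![σ, e.1] ⬝ᵥ y ≤ e.2
  -- (i) every event is charged by many `m`-subsets
  have hlow : ∀ e ∈ E, (F.card - 1 - k).choose (m - 2) ≤ (𝓟.filter fun R => P e R).card := by
    intro e he
    have hev : IsLowEvent σ F k e := (mem_lowEvents hσ).1 he
    set p := (π e).1 with hp
    set q := (π e).2 with hq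
    set U := above σ F e.1 e.2 with hU
    set T : Finset (Fin 2 → ℝ) := U ∪ {p, q} with hT
    set B := F \ T with hB
    have hpU : p ∉ U := fun h => by
      have := (Finset.mem_filter.1 h).2
      rw [hπv1 e he] at this
      exact lt_irrefl _ this
    have hqU : q ∉ U := fun h => by
      have := (Finset.mem_filter.1 h).2
      rw [hπv2 e he] at this
      exact lt_irrefl _ this
    have hTF : T ⊆ F := by
      intro y hy
      rw [hT, Finset.mem_union, Finset.mem_insert, Finset.mem_singleton] at hy
      rcases hy with hy | rfl | rfl
      · exact (Finset.mem_filter.1 hy).1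
      · exact hπ1 e he
      · exact hπ2 e he
    have hTcard : T.card ≤ k + 1 := by
      have h1 : T.card ≤ U.card + ({p, q} : Finset (Fin 2 → ℝ)).card := Finset.card_union_le _ _
      have h2 : ({p, q} : Finset (Fin 2 → ℝ)).card = 2 := Finset.card_pair (hπne e he)
      have h3 : U.card < k := hev.2
      omega
    have hBcard : F.card - 1 - k ≤ B.card := by
      rw [hB, Finset.card_sdiff_of_subset hTF]
      omega
    -- the injection `S ↦ S ∪ {p, q}`
    let g : Finset (Fin 2 → ℝ) → Finset (Fin 2 → ℝ) := fun S => insert p (insert q S)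
    have hSfacts : ∀ S ∈ B.powersetCard (m - 2), S ⊆ B ∧ S.card = m - 2 ∧ p ∉ S ∧ q ∉ S := by
      intro S hS
      obtain ⟨hSB, hSc⟩ := Finset.mem_powersetCard.1 hS
      have hpS : p ∉ S := fun h => by
        have := Finset.mem_sdiff.1 (hSB h)
        exact this.2 (by rw [hT]; simp)
      have hqS : q ∉ S := fun h => by
        have := Finset.mem_sdiff.1 (hSB h)
        exact this.2 (by rw [hT]; simp)
      exact ⟨hSB, hSc, hpS, hqS⟩
    have hmaps : ∀ S ∈ B.powersetCard (m - 2), g S ∈ 𝓟.filter fun R => P e R := by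
      intro S hS
      obtain ⟨hSB, hSc, hpS, hqS⟩ := hSfacts S hS
      have hqS' : q ∉ S := hqS
      have hpS' : p ∉ insert q S := by
        rw [Finset.mem_insert]
        rintro (h | h)
        · exact hπne e he h
        · exact hpS h
      refine Finset.mem_filter.2 ⟨Finset.mem_powersetCard.2 ⟨?_, ?_⟩, ?_, ?_, ?_⟩
      · intro y hy
        rcases Finset.mem_insert.1 hy with rfl | hy
        · exact hπ1 e he
        rcases Finset.mem_insert.1 hy with rfl | hy
        · exact hπ2 e he
        · exact (Finset.mem_sdiff.1 (hSB hy)).1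
      · rw [Finset.card_insert_of_notMem hpS', Finset.card_insert_of_notMem hqS', hSc]
        omega
      · exact Finset.mem_insert_self _ _
      · exact Finset.mem_insert_of_mem (Finset.mem_insert_self _ _)
      · intro y hy
        rcases Finset.mem_insert.1 hy with rfl | hy
        · exact (hπv1 e he).le
        rcases Finset.mem_insert.1 hy with rfl | hy
        · exact (hπv2 e he).le
        · have hyB := Finset.mem_sdiff.1 (hSB hy)
          have hyU : y ∉ U := fun h => hyB.2 (by rw [hT]; exact Finset.mem_union_left _ h)
          by_contra hh
          exact hyU (Finset.mem_filter.2 ⟨hyB.1, lt_of_not_ge hh⟩)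
    have hinj : Set.InjOn g (B.powersetCard (m - 2) : Set (Finset (Fin 2 → ℝ))) := by
      intro S hS S' hS' hSS'
      obtain ⟨-, -, hpS, hqS⟩ := hSfacts S hS
      obtain ⟨-, -, hpS', hqS'⟩ := hSfacts S' hS'
      have h1 : S = ((g S).erase p).erase q := by
        simp only [g]
        rw [Finset.erase_insert (by rw [Finset.mem_insert]; rintro (h | h); exact hπne e he h; exact hpS h),
          Finset.erase_insert hqS]
      have h2 : S' = ((g S').erase p).erase q := by
        simp only [g]
        rw [Finset.erase_insert (by rw [Finset.mem_insert]; rintro (h | h); exact hπne e he h; exact hpS' h),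
          Finset.erase_insert hqS']
      rw [h1, h2, hSS']
    calc (F.card - 1 - k).choose (m - 2) ≤ B.card.choose (m - 2) := Nat.choose_le_choose _ hBcard
      _ = (B.powersetCard (m - 2)).card := (Finset.card_powersetCard _ _).symm
      _ ≤ (𝓟.filter fun R => P e R).card := Finset.card_le_card_of_injOn g hmaps hinj
  -- (ii) for a fixed `R`, the charging events have distinct times, all top ties of `R`
  have hhigh : ∀ R ∈ 𝓟, (E.filter fun e => P e R).card ≤ m := by
    intro R hR
    have hRc : R.card = m := (Finset.mem_powersetCard.1 hR).2
    calc (E.filter fun e => P e R).card ≤ (topTies σ R).card := by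
          refine Finset.card_le_card_of_injOn (fun e => e.1) (fun e he => ?_) ?_
          · obtain ⟨heE, hP⟩ := Finset.mem_filter.1 he
            rw [Finset.mem_coe, mem_topTies hσ]
            exact ⟨(π e).1, hP.1, (π e).2, hP.2.1, hπne e heE, by rw [hπv1 e heE, hπv2 e heE],
              fun y hy => by rw [hπv1 e heE]; exact hP.2.2 y hy⟩
          · intro e he e' he' heq
            obtain ⟨heE, hP⟩ := Finset.mem_filter.1 he
            obtain ⟨heE', hP'⟩ := Finset.mem_filter.1 he'
            simp only at heq
            have h1 : e'.2 ≤ e.2 := by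
              have := hP.2.2 _ hP'.1
              rwa [heq, hπv1 e' heE'] at this
            have h2 : e.2 ≤ e'.2 := by
              have := hP'.2.2 _ hP.1
              rwa [← heq, hπv1 e heE] at this
            exact Prod.ext heq (le_antisymm h2 h1)
      _ ≤ R.card := card_topTies_le hσ
      _ = m := hRc
  -- double count
  calc E.card * (F.card - 1 - k).choose (m - 2)
      ≤ ∑ e ∈ E, (𝓟.filter fun R => P e R).card := by
        rw [← smul_eq_mul]
        exact Finset.card_nsmul_le_sum E _ _ hlow
    _ = ∑ e ∈ E, ∑ R ∈ 𝓟, (if P e R then 1 else 0) := by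
        refine Finset.sum_congr rfl fun e _ => ?_
        rw [Finset.card_filter]
    _ = ∑ R ∈ 𝓟, ∑ e ∈ E, (if P e R then 1 else 0) := Finset.sum_comm
    _ = ∑ R ∈ 𝓟, (E.filter fun e => P e R).card := by
        refine Finset.sum_congr rfl fun R _ => ?_
        rw [Finset.card_filter]
    _ ≤ ∑ _R ∈ 𝓟, m := Finset.sum_le_sum hhigh
    _ = m * F.card.choose m := by rw [Finset.sum_const, smul_eq_mul, Finset.card_powersetCard, mul_comm]

/-! ### Binomial arithmetic -/

/-- Iterated Pascal: `C(N, r) ≤ C(N - s, r) + s · C(N - 1, r - 1)` for `r ≥ 1` (delete the elements of an `s`-set one at a time).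
[folklore] -/
theorem choose_le_choose_sub_add (N r s : ℕ) (hr : 1 ≤ r) :
    N.choose r ≤ (N - s).choose r + s * (N - 1).choose (r - 1) := by
  induction s with
  | zero => simp
  | succ s ih =>
    have hstep : (N - s).choose r ≤ (N - (s + 1)).choose r + (N - 1).choose (r - 1) := by
      rcases Nat.eq_zero_or_pos (N - s) with h0 | hpos
      · rw [h0, Nat.choose_eq_zero_of_lt (by omega)]
        exact Nat.zero_le _
      · obtain ⟨r', rfl⟩ : ∃ r', r = r' + 1 := ⟨r - 1, by omega⟩
        have hNs : N - s = (N - (s + 1)) + 1 := by omega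
        rw [hNs, Nat.choose_succ_succ', Nat.add_sub_cancel]
        rw [add_comm]
        refine Nat.add_le_add_left ?_ _
        exact Nat.choose_le_choose _ (by omega)
    calc N.choose r ≤ (N - s).choose r + s * (N - 1).choose (r - 1) := ih
      _ ≤ (N - (s + 1)).choose r + (N - 1).choose (r - 1) + s * (N - 1).choose (r - 1) :=
          Nat.add_le_add_right hstep _
      _ = (N - (s + 1)).choose r + (s + 1) * (N - 1).choose (r - 1) := by ring

/-- **Union bound for avoiding subsets**: `(N - s·r) · C(N, r) ≤ N · C(N - s, r)` (a uniformly random `r`-subset of an `N`-set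
meets a fixed `s`-set with probability at most `s r / N`). [folklore] -/
theorem sub_mul_choose_le (N r s : ℕ) : (N - s * r) * N.choose r ≤ N * (N - s).choose r := by
  rcases Nat.eq_zero_or_pos r with rfl | hr
  · simp
  rcases Nat.eq_zero_or_pos N with rfl | hN
  · simp
  have h1 := choose_le_choose_sub_add N r s hr
  -- `N · C(N-1, r-1) = r · C(N, r)`
  have h2 : N * (N - 1).choose (r - 1) = N.choose r * r := by
    have := Nat.add_one_mul_choose_eq (N - 1) (r - 1)
    rw [show N - 1 + 1 = N by omega, show r - 1 + 1 = r by omega] at this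
    exact this
  have h3 : N * N.choose r ≤ N * (N - s).choose r + s * r * N.choose r := by
    calc N * N.choose r ≤ N * ((N - s).choose r + s * (N - 1).choose (r - 1)) := Nat.mul_le_mul_left _ h1
      _ = N * (N - s).choose r + s * (N * (N - 1).choose (r - 1)) := by ring
      _ = N * (N - s).choose r + s * r * N.choose r := by rw [h2]; ring
  rw [tsub_mul]
  omega

/-- `m (m-1) C(n, m) = n (n-1) C(n-2, m-2)` for `2 ≤ m`, `2 ≤ n`. [folklore] -/
theorem mul_mul_choose_eq (n m : ℕ) (hm : 2 ≤ m) (hn : 2 ≤ n) :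
    m * (m - 1) * n.choose m = n * (n - 1) * (n - 2).choose (m - 2) := by
  have h1 := Nat.add_one_mul_choose_eq (n - 1) (m - 1)
  rw [show n - 1 + 1 = n by omega, show m - 1 + 1 = m by omega] at h1
  have h2 := Nat.add_one_mul_choose_eq (n - 2) (m - 2)
  rw [show n - 2 + 1 = n - 1 by omega, show m - 2 + 1 = m - 1 by omega] at h2
  -- `n C(n-1,m-1) = C(n,m) m`, `(n-1) C(n-2,m-2) = C(n-1,m-1) (m-1)`
  calc m * (m - 1) * n.choose m = (m - 1) * (n.choose m * m) := by ring
    _ = (m - 1) * (n * (n - 1).choose (m - 1)) := by rw [h1]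
    _ = n * ((n - 1).choose (m - 1) * (m - 1)) := by ring
    _ = n * ((n - 1) * (n - 2).choose (m - 2)) := by rw [h2]
    _ = n * (n - 1) * (n - 2).choose (m - 2) := by ring

/-! ### The linear bound -/

/-- Low events are crossings of pairs: `#lowEvents ≤ |F|²`. [folklore] -/
theorem card_lowEvents_le_sq (σ : ℝ) (F : Finset (Fin 2 → ℝ)) (k : ℕ) : (lowEvents σ F k).card ≤ F.card * F.card := by
  classical
  unfold lowEvents candEvents
  calc _ ≤ (((F ×ˢ F).filter fun pq : (Fin 2 → ℝ) × (Fin 2 → ℝ) => pq.1 1 ≠ pq.2 1).image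
          fun pq => (crossT σ pq.1 pq.2, ![σ, crossT σ pq.1 pq.2] ⬝ᵥ pq.1)).card := Finset.card_filter_le _ _
    _ ≤ ((F ×ˢ F).filter fun pq : (Fin 2 → ℝ) × (Fin 2 → ℝ) => pq.1 1 ≠ pq.2 1).card := Finset.card_image_le
    _ ≤ (F ×ˢ F).card := Finset.card_filter_le _ _
    _ = F.card * F.card := Finset.card_product _ _

/-- **The `(≤ k)`-level bound**: `#lowEvents σ F k ≤ 16 · |F| · k` for `k ≥ 1`.  [folklore: Clarkson–Shor; the `(≤ k)`-level of
`n` lines has `O(nk)` vertices] -/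
theorem card_lowEvents_le {σ : ℝ} (hσ : σ ≠ 0) (F : Finset (Fin 2 → ℝ)) {k : ℕ} (hk : 1 ≤ k) :
    (lowEvents σ F k).card ≤ 16 * F.card * k := by
  set n := F.card with hn
  set Ecard := (lowEvents σ F k).card with hEc
  by_cases hsmall : n < 16 * k
  · -- few points: the quadratic bound suffices
    calc Ecard ≤ n * n := card_lowEvents_le_sq σ F k
      _ ≤ n * (16 * k) := Nat.mul_le_mul_left _ hsmall.le
      _ = 16 * n * k := by ring
  push Not at hsmall
  -- many points: sample size `m = ⌊n / 4k⌋`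
  set m := n / (4 * k) with hm
  have hk4 : 0 < 4 * k := by omega
  have hm4 : 4 ≤ m := by
    rw [hm, Nat.le_div_iff_mul_le hk4]
    omega
  have hmle : m * (4 * k) ≤ n := Nat.div_mul_le_self n (4 * k)
  have hmlt : n < m * (4 * k) + 4 * k := by
    have := Nat.lt_div_mul_add (a := n) hk4
    rw [← hm] at this
    linarith
  have h4m : 4 * m ≤ n := le_trans (by nlinarith) hmle
  have hn2 : 2 ≤ n := by omega
  -- the double count
  have hCS := card_lowEvents_mul_choose_le hσ F k m (by omega)
  rw [← hn, ← hEc] at hCS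
  -- the binomial comparison `C(n-2, m-2) ≤ 2 C(n-1-k, m-2)`
  have hUB := sub_mul_choose_le (n - 2) (m - 2) (k - 1)
  have hNs : n - 2 - (k - 1) = n - 1 - k := by omega
  rw [hNs] at hUB
  have hprod : (k - 1) * (m - 2) ≤ k * m := Nat.mul_le_mul (by omega) (by omega)
  have hkm : k * m * 4 ≤ n := by nlinarith
  have hcoef : n - 2 ≤ 2 * (n - 2 - (k - 1) * (m - 2)) := by omega
  have hC2 : (n - 2) * (n - 2).choose (m - 2) ≤ (n - 2) * (2 * (n - 1 - k).choose (m - 2)) := by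
    calc (n - 2) * (n - 2).choose (m - 2) ≤ 2 * (n - 2 - (k - 1) * (m - 2)) * (n - 2).choose (m - 2) :=
          Nat.mul_le_mul_right _ hcoef
      _ = 2 * ((n - 2 - (k - 1) * (m - 2)) * (n - 2).choose (m - 2)) := by ring
      _ ≤ 2 * ((n - 2) * (n - 1 - k).choose (m - 2)) := Nat.mul_le_mul_left _ hUB
      _ = (n - 2) * (2 * (n - 1 - k).choose (m - 2)) := by ring
  have hC2' : (n - 2).choose (m - 2) ≤ 2 * (n - 1 - k).choose (m - 2) :=
    Nat.le_of_mul_le_mul_left hC2 (by omega)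
  -- positivity of the smaller binomial
  have hpos : 0 < (n - 1 - k).choose (m - 2) := Nat.choose_pos (by omega)
  -- assemble: `E · C' · (m-1) ≤ m (m-1) C(n,m) = n(n-1) C(n-2,m-2) ≤ 2 n (n-1) C'`
  have hid := mul_mul_choose_eq n m (by omega) hn2
  have hchain : Ecard * (m - 1) * (n - 1 - k).choose (m - 2) ≤ 2 * n * (n - 1) * (n - 1 - k).choose (m - 2) := by
    calc Ecard * (m - 1) * (n - 1 - k).choose (m - 2) = (m - 1) * (Ecard * (n - 1 - k).choose (m - 2)) := by ring
      _ ≤ (m - 1) * (m * n.choose m) := Nat.mul_le_mul_left _ hCS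
      _ = m * (m - 1) * n.choose m := by ring
      _ = n * (n - 1) * (n - 2).choose (m - 2) := hid
      _ ≤ n * (n - 1) * (2 * (n - 1 - k).choose (m - 2)) := Nat.mul_le_mul_left _ hC2'
      _ = 2 * n * (n - 1) * (n - 1 - k).choose (m - 2) := by ring
  have hE1 : Ecard * (m - 1) ≤ 2 * n * (n - 1) := Nat.le_of_mul_le_mul_right hchain hpos
  -- `(m - 1) · 8k ≥ n`
  have hm8 : n ≤ (m - 1) * (8 * k) := by
    have : (m - 1) * (8 * k) = m * (4 * k) * 2 - 8 * k := by
      rw [tsub_mul]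
      ring_nf
    omega
  have hfinal : Ecard * n ≤ 16 * n * k * n := by
    calc Ecard * n ≤ Ecard * ((m - 1) * (8 * k)) := Nat.mul_le_mul_left _ hm8
      _ = Ecard * (m - 1) * (8 * k) := by ring
      _ ≤ 2 * n * (n - 1) * (8 * k) := Nat.mul_le_mul_right _ hE1
      _ ≤ 2 * n * n * (8 * k) := by gcongr; omega
      _ = 16 * n * k * n := by ring
  exact Nat.le_of_mul_le_mul_right hfinal (by omega)

end TotalsLaw

end Summit.ValiantsHypothesis.ValiantsHypothesis.Theorems.NewtonUnitEquationsDissociatedUniform
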